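import Summits.QuantumFields.GaugeBoot.OrbitAverages
import HarnessLib

/-!
# Gauge-boot: certified windows pass to infinite-volume limit points (along even tori)

Cell `pub-gaugeboot`, task L0, file 4/4 (theorems only; imports `OrbitAverages`).

HONEST FRAMING (page 1 of every file of this cell): certified bounds on lattice expectations at
STATED coupling, gauge group, dimension and torus size; NOT a mass gap, NOT a continuum limit,
NOT a string tension, NOT large `N`. The venture is explicitly NOT Yang–Mills-summit-bearing
(barriers `FixedCouplingUltralocality`, `PerturbativeInvisibility`: fixed-coupling ultralocal data
say nothing about `a → 0`).

Tree notion: `IsInfiniteVolumeLimitAlong ρ β L μ` (`LatticeGaugeDLR`) — the probability measure `μ` on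
configurations of `ℤ^D` is the limit of the torus Wilson states `μ_{(ℤ/(L_k+1))^D, β}` on bounded
continuous cylinder observables. A shape-(A) certificate speaks about EVEN tori `L ≥ L₀` only, so the
corollary is stated for limits along sequences of even sides `L_k + 1`:
`PlaquetteWindow.integral_limit_mem` (`a ≤ ∫ (1/N) Re tr U_P dμ ≤ b` for every plaquette of `ℤ^D`) and
`WilsonLoopWindow.integral_limit_mem` (the same for the tree's `ℤ^D` Wilson loop observable
`wilsonLoopObs ((1/N) Re tr ∘ ρ) (rectWalk x i j R T)`). No uniqueness of the infinite-volume limit is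
claimed (open at weak coupling); existence of limit points along any subsequence is the tree fact
`infiniteVolumeLimitPoints_nonempty`.
-/

noncomputable section

open MeasureTheory Filter Topology
open Literature.MathematicalPhysics.QuantumFieldTheory
open Literature.MathematicalPhysics.QuantumLattice (fundamentalRep continuous_fundamentalRep
  LGConfig plaquetteObs plaquetteHolonomyZd torusLift toTorusObservable IsCylinder
  IsInfiniteVolumeLimitAlong torusLogPartition)
open Literature.RepresentationTheory.CompactGroups

namespace Summit.QuantumFields.GaugeBoot

section Limit

open Literature.MathematicalPhysics.QuantumLattice (wilsonLoopObs rectWalk walkHolonomy_rectWalk_eq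
  isCylinder_wilsonLoopObs continuous_wilsonLoopObs exists_abs_wilsonLoopObs_le normalisedCharacter
  continuous_normalisedCharacter_comp torusProj_add_single)
open Literature.Probability.LatticeModels (Torus.proj)

/-- Sites of `ℤ^D` (tree `Literature.Probability.LatticeModels.Site`). -/
local notation "ZdSite" => Literature.Probability.LatticeModels.Site

variable {D N : ℕ} {G : Type*} [Group G] (ρ : G →* Matrix (Fin N) (Fin N) ℂ)

/-- The plaquette holonomy of the periodic lift is the torus plaquette holonomy below it. [folklore] -/
theorem plaquetteHolonomyZd_torusLift (L : ℕ) (U : GaugeConfig D L G) (x : ZdSite D) (i j : Fin D) :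
    plaquetteHolonomyZd (torusLift L U) x i j = plaquetteHolonomy U (Torus.proj L x) i j := by
  simp only [plaquetteHolonomyZd, plaquetteHolonomy, torusLift, Function.comp_apply,
    Literature.MathematicalPhysics.QuantumLattice.torusEdge, Site.shift, torusProj_add_single, Int.cast_one]

/-- The normalised `ℤ^D` plaquette observable restricted to the torus is `u_P` at the projected
site. [folklore] -/
theorem toTorusObservable_plaquetteObs (L : ℕ) (x : ZdSite D) (i j : Fin D) :
    toTorusObservable L (fun U : LGConfig D G => (N : ℝ)⁻¹ * plaquetteObs ρ x i j U) =
      plaquetteTrace ρ (Torus.proj L x) i j := by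
  funext U
  simp only [toTorusObservable, Function.comp_apply, plaquetteObs, plaquetteHolonomyZd_torusLift,
    plaquetteTrace]

/-- The `ℤ^D` rectangular Wilson loop observable restricted to the torus is the torus Wilson loop at
the projected base point (tree `walkHolonomy_rectWalk_eq`). [folklore] -/
theorem toTorusObservable_wilsonLoopObs_rectWalk (L : ℕ) (x : ZdSite D) (i j : Fin D) (R T : ℕ) :
    toTorusObservable L (wilsonLoopObs (normalisedCharacter N ∘ ρ) (rectWalk x i j R T)) =
      wilsonLoop (G := G) ρ (Torus.proj L x) i j R T := by
  funext U
  simp only [toTorusObservable, Function.comp_apply, wilsonLoopObs, walkHolonomy_rectWalk_eq,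
    normalisedCharacter, wilsonLoop]

variable {L₀ : ℕ} {β a b : ℝ}

/-- **Certified windows pass to infinite-volume limit points (plaquette).** If `μ` is an
infinite-volume limit of the `SU(N)` torus Wilson states at `β_std` along a sequence of EVEN torus
sides `L_k + 1 → ∞` (tree notion `IsInfiniteVolumeLimitAlong`, convergence on bounded continuous
cylinder observables), then every plaquette of `ℤ^D` satisfies `a ≤ ∫ (1/N) Re tr U_P dμ ≤ b`.
No uniqueness of the limit is claimed (open at weak coupling); limits along odd tori are not
covered by a shape-(A) certificate. -/
theorem PlaquetteWindow.integral_limit_mem (h : PlaquetteWindow N D L₀ β a b) {Lk : ℕ → ℕ}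
    (hmono : StrictMono Lk) (heven : ∀ k, Even (Lk k + 1)) {μ : Measure (LGConfig D (SU N))}
    (hμ : IsInfiniteVolumeLimitAlong (suRep N) (β / N) Lk μ) (x : ZdSite D) {i j : Fin D}
    (hij : i ≠ j) :
    a ≤ ∫ U, (N : ℝ)⁻¹ * plaquetteObs (suRep N) x i j U ∂μ ∧
      ∫ U, (N : ℝ)⁻¹ * plaquetteObs (suRep N) x i j U ∂μ ≤ b := by
  set F : LGConfig D (SU N) → ℝ := fun U => (N : ℝ)⁻¹ * plaquetteObs (suRep N) x i j U with hF
  -- `F` is a bounded continuous cylinder observable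
  have hcyl : IsCylinder F ({(x, i), (x + Pi.single i 1, j), (x + Pi.single j 1, i), (x, j)} :
      Finset (Literature.MathematicalPhysics.QuantumLattice.ZdEdge D)) := by
    intro U V hUV
    simp only [hF, plaquetteObs, plaquetteHolonomyZd]
    rw [hUV (x, i) (by simp), hUV (x + Pi.single i 1, j) (by simp), hUV (x + Pi.single j 1, i) (by simp),
      hUV (x, j) (by simp)]
  have hcont : Continuous F := by
    have h1 : Continuous fun U : LGConfig D (SU N) => plaquetteHolonomyZd U x i j := by
      unfold plaquetteHolonomyZd; fun_prop
    exact continuous_const.mul ((continuous_trace_re (suRep N) (continuous_suRep N)).comp h1)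
  have hbd : ∃ C, ∀ U, |F U| ≤ C := by
    refine ⟨1, fun U => ?_⟩
    have h := CompactGroup.abs_re_trace_le_card (suRep N) (continuous_suRep N) (plaquetteHolonomyZd U x i j)
    rw [Fintype.card_fin] at h
    simp only [hF, plaquetteObs]
    rcases Nat.eq_zero_or_pos N with hN | hN
    · subst hN; simp
    · rw [abs_mul, abs_inv, Nat.abs_cast]
      calc (N : ℝ)⁻¹ * |((suRep N) (plaquetteHolonomyZd U x i j)).trace.re| ≤ (N : ℝ)⁻¹ * N := by
            gcongr
        _ = 1 := inv_mul_cancel₀ (by exact_mod_cast hN.ne')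
  have hlim := hμ.2 F _ hcyl hcont hbd
  simp only [hF, toTorusObservable_plaquetteObs] at hlim
  -- eventually the torus is even and large, so the certificate applies to the projected plaquette
  have hev : ∀ᶠ k in atTop, a ≤ wilsonExpectation (suRep N) (β / N)
      (plaquetteTrace (suRep N) (Torus.proj (Lk k + 1) x) i j) ∧
      wilsonExpectation (suRep N) (β / N) (plaquetteTrace (suRep N) (Torus.proj (Lk k + 1) x) i j) ≤ b :=
    Filter.eventually_atTop.2 ⟨L₀, fun k hk =>
      h.plaquetteTrace_mem (Lk k + 1) (heven k) ((hk.trans (hmono.id_le k)).trans (Nat.le_succ _)) _ hij⟩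
  exact ⟨ge_of_tendsto hlim (hev.mono fun k hk => hk.1), le_of_tendsto hlim (hev.mono fun k hk => hk.2)⟩

/-- **Certified windows pass to infinite-volume limit points (rectangular loops).** Same as
`PlaquetteWindow.integral_limit_mem` for the `R × T` Wilson loop observable
`wilsonLoopObs ((1/N) Re tr ∘ ρ) (rectWalk x i j R T)` of `ℤ^D`. -/
theorem WilsonLoopWindow.integral_limit_mem {R T : ℕ} (h : WilsonLoopWindow N D L₀ β R T a b)
    {Lk : ℕ → ℕ} (hmono : StrictMono Lk) (heven : ∀ k, Even (Lk k + 1))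
    {μ : Measure (LGConfig D (SU N))} (hμ : IsInfiniteVolumeLimitAlong (suRep N) (β / N) Lk μ)
    (x : ZdSite D) {i j : Fin D} (hij : i ≠ j) :
    a ≤ ∫ U, wilsonLoopObs (normalisedCharacter N ∘ suRep N) (rectWalk x i j R T) U ∂μ ∧
      ∫ U, wilsonLoopObs (normalisedCharacter N ∘ suRep N) (rectWalk x i j R T) U ∂μ ≤ b := by
  have hχ := continuous_normalisedCharacter_comp (N := N) (continuous_suRep N)
  have hlim := hμ.2 _ _ (isCylinder_wilsonLoopObs (normalisedCharacter N ∘ suRep N) (rectWalk x i j R T))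
    (continuous_wilsonLoopObs hχ _) (exists_abs_wilsonLoopObs_le hχ _)
  simp only [toTorusObservable_wilsonLoopObs_rectWalk] at hlim
  have hev : ∀ᶠ k in atTop, a ≤ wilsonExpectation (suRep N) (β / N)
      (wilsonLoop (suRep N) (Torus.proj (Lk k + 1) x) i j R T) ∧
      wilsonExpectation (suRep N) (β / N) (wilsonLoop (suRep N) (Torus.proj (Lk k + 1) x) i j R T) ≤ b :=
    Filter.eventually_atTop.2 ⟨L₀, fun k hk =>
      h.wilsonLoop_mem (Lk k + 1) (heven k) ((hk.trans (hmono.id_le k)).trans (Nat.le_succ _)) _ hij⟩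
  exact ⟨ge_of_tendsto hlim (hev.mono fun k hk => hk.1), le_of_tendsto hlim (hev.mono fun k hk => hk.2)⟩

end Limit

end Summit.QuantumFields.GaugeBoot

end
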